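import Summits.QuantumFields.YangMills.Theorems.ConvexGribovBodyCovarianceBoundStubSupMeasurable
import Literature.MathematicalPhysics.QuantumLattice.HeatKernelGroupGaugeProofs

/-!
# Stub `stub_gaugeAlgebra` of the line `SketchIdeator1` for the crux `BrascampLiebVacuumSC`
# (stmt-QuantumFields-16404, route `ConvexGribovBody`)

Pure finite matrix algebra on the time-zero slice of the torus `(2S+1)⁴`, valid for every group `G`,
every unitary matrix representation `r` and every gauge `h` (no measure theory). Write
`V_ℓ = ρ((U^h)_ℓ)` (unitary) for a slice link `ℓ = ((0,y), j+1)`, `dev V = N − Re tr V`,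
`hdev V = ‖1 − ½(V + Vᴴ)‖²_F` and `A_ℓ = ½(V_ℓ − V_ℓᴴ)` (`gluon`). Three facts:

1. `‖½(V − Vᴴ)‖²_F + ‖1 − ½(V + Vᴴ)‖²_F = ‖1 − V‖²_F` for every square matrix `V` (orthogonality of
   the Hermitian and anti-Hermitian parts of `1 − V`, i.e. the parallelogram law entrywise), and
   `‖1 − V‖²_F = 2 dev V` for unitary `V`; hence `‖A_ℓ‖²_F = 2 dev V_ℓ − hdev V_ℓ` exactly.
2. `dev (a b) ≤ 2 (dev a + dev b)` for unitaries (`1 − ab = (1 − a) + a(1 − b)`, unitary invariance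
   of the Frobenius norm, `‖X + Y‖² ≤ 2‖X‖² + 2‖Y‖²`), `dev a⁻¹ = dev a`, so a plaquette
   `a b c⁻¹ d⁻¹` has `dev ≤ 4 (dev a + dev b + dev c + dev d)`; and `dev` of a plaquette holonomy is
   gauge invariant (`plaquetteHolonomy_gaugeTransform`, cyclicity of the trace), so it may be
   computed from the gauge-transformed links `(U^h)_ℓ`.
3. On the 3-torus slice every link lies in four slice plaquettes: reindexing the site sums by the
   translations `y ↦ y + e_j` gives `Σ_p dev ≤ 16 Σ_ℓ dev V_ℓ`.

Then `(1/8) Σ_p dev − Σ_ℓ hdev ≤ 2 Σ_ℓ dev − Σ_ℓ hdev = Σ_ℓ ‖A_ℓ‖²_F`, which is the stub.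

Helper lemmas live in the sub-namespace `GaugeAlgebra`; they are stated directly in terms of
`r.ρ g` (no new definitions). No named facts are used.
-/

set_option autoImplicit false

open scoped BigOperators Topology Matrix
open Filter MeasureTheory ProbabilityTheory
open Literature.MathematicalPhysics.QuantumFieldTheory
open Summit.QuantumFields.YangMills.Cruxes.CovarianceBound.SupportWindow
  (froSq coulombF IsCoulMin gluon modeCov supCov wilson4)

noncomputable section

namespace Summit.QuantumFields.YangMills.Theorems.BrascampLiebVacuumSC

namespace GaugeAlgebra

/-! ### The squared Frobenius norm `froSq` -/

/-- `froSq M = Re tr (Mᴴ M)`. [folklore] -/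
theorem froSq_eq_re_trace {N : ℕ} (M : Matrix (Fin N) (Fin N) ℂ) :
    froSq M = (Mᴴ * M).trace.re := by
  -- adapted from Literature.MathematicalPhysics.QuantumFieldTheory.
  --   sum_norm_sq_eq_re_trace_conjTranspose_mul_self (AdmissiblePlaquetteWeightProofs)
  unfold froSq
  simp only [Matrix.trace, Matrix.diag_apply, Matrix.mul_apply, Matrix.conjTranspose_apply,
    Complex.re_sum, Complex.star_def]
  rw [Finset.sum_comm]
  refine Finset.sum_congr rfl fun j _ => Finset.sum_congr rfl fun i _ => ?_
  rw [Complex.conj_mul', ← Complex.ofReal_pow, Complex.ofReal_re]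

/-- Unitary invariance: `froSq (A M) = froSq M` for unitary `A`. [folklore] -/
theorem froSq_unitary_mul {N : ℕ} {A : Matrix (Fin N) (Fin N) ℂ}
    (hA : A ∈ Matrix.unitaryGroup (Fin N) ℂ) (M : Matrix (Fin N) (Fin N) ℂ) :
    froSq (A * M) = froSq M := by
  have hA' : Aᴴ * A = 1 := by
    rw [← Matrix.star_eq_conjTranspose]; exact Matrix.mem_unitaryGroup_iff'.1 hA
  rw [froSq_eq_re_trace, froSq_eq_re_trace, Matrix.conjTranspose_mul, Matrix.mul_assoc,
    ← Matrix.mul_assoc Aᴴ, hA', Matrix.one_mul]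

/-- `froSq (X + Y) ≤ 2 froSq X + 2 froSq Y` (entrywise `|x + y|² ≤ 2|x|² + 2|y|²`). [folklore] -/
theorem froSq_add_le {N : ℕ} (X Y : Matrix (Fin N) (Fin N) ℂ) :
    froSq (X + Y) ≤ 2 * froSq X + 2 * froSq Y := by
  unfold froSq
  rw [Finset.mul_sum, Finset.mul_sum, ← Finset.sum_add_distrib]
  refine Finset.sum_le_sum fun a _ => ?_
  rw [Finset.mul_sum, Finset.mul_sum, ← Finset.sum_add_distrib]
  refine Finset.sum_le_sum fun b _ => ?_
  rw [Matrix.add_apply]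
  nlinarith [norm_add_le (X a b) (Y a b), norm_nonneg (X a b + Y a b), norm_nonneg (X a b),
    norm_nonneg (Y a b), sq_nonneg (‖X a b‖ - ‖Y a b‖)]

/-- For unitary `V`: `froSq (1 − V) = 2 (N − Re tr V)` (`(1 − V)ᴴ(1 − V) = 2 − V − Vᴴ`).
[folklore] -/
theorem froSq_one_sub_of_mem_unitaryGroup {N : ℕ} {V : Matrix (Fin N) (Fin N) ℂ}
    (hV : V ∈ Matrix.unitaryGroup (Fin N) ℂ) :
    froSq (1 - V) = 2 * ((N : ℝ) - V.trace.re) := by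
  -- adapted from Literature.MathematicalPhysics.QuantumFieldTheory.
  --   sum_norm_sq_one_sub_eq_of_mem_unitaryGroup (AdmissiblePlaquetteWeightProofs)
  rw [froSq_eq_re_trace]
  have hVV : Vᴴ * V = 1 := by
    rw [← Matrix.star_eq_conjTranspose]; exact Matrix.mem_unitaryGroup_iff'.1 hV
  have h : ((1 : Matrix (Fin N) (Fin N) ℂ) - V)ᴴ * (1 - V) = 1 - V - (Vᴴ - 1) := by
    rw [Matrix.conjTranspose_sub, Matrix.conjTranspose_one, sub_mul, one_mul, mul_sub, mul_one,
      hVV]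
  rw [h, Matrix.trace_sub, Matrix.trace_sub, Matrix.trace_sub, Matrix.trace_one,
    Matrix.trace_conjTranspose, Fintype.card_fin]
  simp only [Complex.sub_re, Complex.natCast_re, Complex.star_def, Complex.conj_re]
  ring

/-- The parallelogram law in `ℂ`, halved: `|½(x − ȳ)|² + |½(x + ȳ)|² = ½(|x|² + |y|²)`.
[folklore] -/
theorem norm_sq_half_sub_add_norm_sq_half_add (x y : ℂ) :
    ‖(1 / 2 : ℂ) * (x - star y)‖ ^ 2 + ‖(1 / 2 : ℂ) * (x + star y)‖ ^ 2 =
      (1 / 2) * (‖x‖ ^ 2 + ‖y‖ ^ 2) := by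
  have h := parallelogram_law_with_norm ℂ x (star y)
  rw [norm_star] at h
  have h2 : ‖(1 / 2 : ℂ)‖ = 1 / 2 := by norm_num
  rw [norm_mul, norm_mul, mul_pow, mul_pow, h2]
  linear_combination (1 / 4 : ℝ) * h

/-- Entrywise form with a real diagonal entry `δ`:
`|½(v − w̄)|² + |δ − ½(v + w̄)|² = ½(|δ − v|² + |δ − w|²)`. [folklore] -/
theorem norm_sq_entry_identity {δ : ℂ} (hδ : star δ = δ) (v w : ℂ) :
    ‖(1 / 2 : ℂ) * (v - star w)‖ ^ 2 + ‖δ - (1 / 2 : ℂ) * (v + star w)‖ ^ 2 =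
      (1 / 2) * (‖δ - v‖ ^ 2 + ‖δ - w‖ ^ 2) := by
  have h := norm_sq_half_sub_add_norm_sq_half_add (δ - v) (δ - w)
  rw [star_sub, hδ] at h
  have e1 : (1 / 2 : ℂ) * (δ - v - (δ - star w)) = -((1 / 2 : ℂ) * (v - star w)) := by ring
  have e2 : (1 / 2 : ℂ) * (δ - v + (δ - star w)) = δ - (1 / 2 : ℂ) * (v + star w) := by ring
  rw [e1, e2, norm_neg] at h
  exact h

/-- **Orthogonality of the Hermitian and anti-Hermitian parts of `1 − V`**: for every square matrix
`V`, `‖½(V − Vᴴ)‖²_F + ‖1 − ½(V + Vᴴ)‖²_F = ‖1 − V‖²_F`. [folklore] -/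
theorem froSq_antiHerm_add_froSq_one_sub_herm {N : ℕ} (V : Matrix (Fin N) (Fin N) ℂ) :
    froSq ((1 / 2 : ℂ) • (V - Vᴴ)) + froSq (1 - (1 / 2 : ℂ) • (V + Vᴴ)) = froSq (1 - V) := by
  have key : ∀ a b : Fin N,
      ‖((1 / 2 : ℂ) • (V - Vᴴ)) a b‖ ^ 2 +
          ‖((1 : Matrix (Fin N) (Fin N) ℂ) - (1 / 2 : ℂ) • (V + Vᴴ)) a b‖ ^ 2 =
        (1 / 2) * (‖((1 : Matrix (Fin N) (Fin N) ℂ) - V) a b‖ ^ 2 +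
          ‖((1 : Matrix (Fin N) (Fin N) ℂ) - V) b a‖ ^ 2) := by
    intro a b
    have h1 : (1 : Matrix (Fin N) (Fin N) ℂ) b a = (1 : Matrix (Fin N) (Fin N) ℂ) a b := by
      rw [← Matrix.transpose_apply (1 : Matrix (Fin N) (Fin N) ℂ) a b, Matrix.transpose_one]
    have hδ : star ((1 : Matrix (Fin N) (Fin N) ℂ) a b) = (1 : Matrix (Fin N) (Fin N) ℂ) a b := by
      rw [← Matrix.conjTranspose_apply, Matrix.conjTranspose_one, h1]
    simp only [Matrix.smul_apply, Matrix.sub_apply, Matrix.add_apply, Matrix.conjTranspose_apply,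
      smul_eq_mul, h1]
    exact norm_sq_entry_identity hδ (V a b) (V b a)
  unfold froSq
  simp_rw [← Finset.sum_add_distrib, key, mul_add, Finset.sum_add_distrib, ← Finset.mul_sum]
  have hc : ∑ a : Fin N, ∑ b : Fin N, ‖((1 : Matrix (Fin N) (Fin N) ℂ) - V) b a‖ ^ 2 =
      ∑ a : Fin N, ∑ b : Fin N, ‖((1 : Matrix (Fin N) (Fin N) ℂ) - V) a b‖ ^ 2 :=
    Finset.sum_comm
  rw [hc]
  ring

/-! ### Trace deviations `N − Re tr ρ(g)` of a unitary representation -/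

variable {G : Type*} [Group G] [TopologicalSpace G]

/-- `‖½(ρ(g) − ρ(g)ᴴ)‖²_F = 2 (N − Re tr ρ(g)) − ‖1 − ½(ρ(g) + ρ(g)ᴴ)‖²_F` for the unitary `ρ(g)`.
[folklore] -/
theorem froSq_half_sub_conjTranspose_eq (r : LatticeRep G) (g : G) :
    froSq ((1 / 2 : ℂ) • (r.ρ g - (r.ρ g)ᴴ)) =
      2 * ((r.N : ℝ) - (r.ρ g).trace.re) - froSq (1 - (1 / 2 : ℂ) • (r.ρ g + (r.ρ g)ᴴ)) := by
  have h1 := froSq_antiHerm_add_froSq_one_sub_herm (r.ρ g)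
  rw [froSq_one_sub_of_mem_unitaryGroup (r.mem_unitary g)] at h1
  linarith

/-- A unitary representation sends inverses to adjoints: `ρ(g⁻¹) = ρ(g)ᴴ`. [folklore] -/
theorem map_inv_eq_conjTranspose (r : LatticeRep G) (g : G) : r.ρ g⁻¹ = (r.ρ g)ᴴ := by
  -- adapted from Literature.MathematicalPhysics.QuantumFieldTheory.TiltedTorusRP.map_inv_eq_star
  have h1 : r.ρ g⁻¹ * r.ρ g = 1 := by rw [← map_mul, inv_mul_cancel, map_one]
  have h2 : r.ρ g * (r.ρ g)ᴴ = 1 := by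
    rw [← Matrix.star_eq_conjTranspose]; exact Matrix.mem_unitaryGroup_iff.1 (r.mem_unitary g)
  calc r.ρ g⁻¹ = r.ρ g⁻¹ * (r.ρ g * (r.ρ g)ᴴ) := by rw [h2, mul_one]
    _ = (r.ρ g)ᴴ := by rw [← mul_assoc, h1, one_mul]

/-- `N − Re tr ρ(g⁻¹) = N − Re tr ρ(g)`. [folklore] -/
theorem dev_inv (r : LatticeRep G) (g : G) :
    (r.N : ℝ) - (r.ρ g⁻¹).trace.re = (r.N : ℝ) - (r.ρ g).trace.re := by
  rw [map_inv_eq_conjTranspose, Matrix.trace_conjTranspose, Complex.star_def, Complex.conj_re]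

/-- `Re tr ρ(g a g⁻¹) = Re tr ρ(a)` (cyclicity of the trace). [folklore] -/
theorem re_trace_conj (r : LatticeRep G) (g a : G) :
    (r.ρ (g * a * g⁻¹)).trace.re = (r.ρ a).trace.re := by
  rw [map_mul, map_mul, Matrix.trace_mul_cycle, ← map_mul, inv_mul_cancel, map_one, one_mul]

/-- Subadditivity up to a factor two: `N − Re tr ρ(ab) ≤ 2 ((N − Re tr ρ(a)) + (N − Re tr ρ(b)))`
(`dev = ½‖1 − ·‖²_F`, `1 − AB = (1 − A) + A(1 − B)`, unitary invariance,
`‖X + Y‖² ≤ 2‖X‖² + 2‖Y‖²`). [folklore] -/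
theorem dev_mul_le (r : LatticeRep G) (a b : G) :
    (r.N : ℝ) - (r.ρ (a * b)).trace.re ≤
      2 * (((r.N : ℝ) - (r.ρ a).trace.re) + ((r.N : ℝ) - (r.ρ b).trace.re)) := by
  have ha := r.mem_unitary a
  have hb := r.mem_unitary b
  have hab : r.ρ a * r.ρ b ∈ Matrix.unitaryGroup (Fin r.N) ℂ := mul_mem ha hb
  have e1 : (r.N : ℝ) - (r.ρ (a * b)).trace.re = (1 / 2) * froSq (1 - r.ρ a * r.ρ b) := by
    rw [map_mul, froSq_one_sub_of_mem_unitaryGroup hab]; ring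
  have e2 : (r.N : ℝ) - (r.ρ a).trace.re = (1 / 2) * froSq (1 - r.ρ a) := by
    rw [froSq_one_sub_of_mem_unitaryGroup ha]; ring
  have e3 : (r.N : ℝ) - (r.ρ b).trace.re = (1 / 2) * froSq (1 - r.ρ b) := by
    rw [froSq_one_sub_of_mem_unitaryGroup hb]; ring
  have hsplit : (1 : Matrix (Fin r.N) (Fin r.N) ℂ) - r.ρ a * r.ρ b =
      (1 - r.ρ a) + r.ρ a * (1 - r.ρ b) := by
    rw [mul_sub, mul_one]; abel
  have key : froSq (1 - r.ρ a * r.ρ b) ≤ 2 * froSq (1 - r.ρ a) + 2 * froSq (1 - r.ρ b) := by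
    rw [hsplit]
    calc froSq ((1 - r.ρ a) + r.ρ a * (1 - r.ρ b))
        ≤ 2 * froSq (1 - r.ρ a) + 2 * froSq (r.ρ a * (1 - r.ρ b)) := froSq_add_le _ _
      _ = 2 * froSq (1 - r.ρ a) + 2 * froSq (1 - r.ρ b) := by rw [froSq_unitary_mul ha]
  rw [e1, e2, e3]
  linarith

/-- The plaquette word: `N − Re tr ρ(a b c⁻¹ d⁻¹) ≤ 4 Σ (N − Re tr ρ(·))` over `a, b, c, d`
(`a b c⁻¹ d⁻¹ = (a b)(c⁻¹ d⁻¹)`, `dev_mul_le` three times, `dev_inv`). [folklore] -/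
theorem dev_plaquetteWord_le (r : LatticeRep G) (a b c d : G) :
    (r.N : ℝ) - (r.ρ (a * b * c⁻¹ * d⁻¹)).trace.re ≤
      4 * (((r.N : ℝ) - (r.ρ a).trace.re) + ((r.N : ℝ) - (r.ρ b).trace.re) +
        ((r.N : ℝ) - (r.ρ c).trace.re) + ((r.N : ℝ) - (r.ρ d).trace.re)) := by
  have h1 := dev_mul_le r (a * b) (c⁻¹ * d⁻¹)
  have h2 := dev_mul_le r a b
  have h3 := dev_mul_le r c⁻¹ d⁻¹
  rw [dev_inv, dev_inv] at h3
  rw [mul_assoc (a * b)]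
  linarith

/-- **Plaquette deviation versus its links, in any gauge**: `N − Re tr ρ(U_p)` is gauge invariant
(`plaquetteHolonomy_gaugeTransform` and cyclicity), and for the gauge-transformed links of
`p = (x; i, j)` it is at most `4` times the sum of the four link deviations. [folklore] -/
theorem dev_plaquetteHolonomy_le (r : LatticeRep G) {d L : ℕ} (U : GaugeConfig d L G)
    (h : Site d L → G) (x : Site d L) (i j : Fin d) :
    (r.N : ℝ) - (r.ρ (plaquetteHolonomy U x i j)).trace.re ≤
      4 * (((r.N : ℝ) - (r.ρ (gaugeTransform h U (x, i))).trace.re) +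
        ((r.N : ℝ) - (r.ρ (gaugeTransform h U (x.shift i, j))).trace.re) +
        ((r.N : ℝ) - (r.ρ (gaugeTransform h U (x.shift j, i))).trace.re) +
        ((r.N : ℝ) - (r.ρ (gaugeTransform h U (x, j))).trace.re)) := by
  rw [← re_trace_conj r (h x) (plaquetteHolonomy U x i j),
    ← Literature.MathematicalPhysics.QuantumLattice.plaquetteHolonomy_gaugeTransform]
  exact dev_plaquetteWord_le r _ _ _ _

/-! ### Combinatorics of the time-zero slice -/

/-- Shifting the slice site `(0, y)` in a spatial direction keeps the time coordinate `0`: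
`(0, y) + e_{j+1} = (0, y + e_j)`. [folklore] -/
theorem cons_zero_shift_succ {L : ℕ} (y : Fin 3 → ZMod L) (j : Fin 3) :
    Site.shift (d := 4) (Fin.cons (0 : ZMod L) y) j.succ =
      Fin.cons (0 : ZMod L) (y + Pi.single j 1) := by
  funext m
  simp only [Site.shift, Pi.add_apply]
  refine Fin.cases ?_ (fun i => ?_) m
  · simp only [Fin.cons_zero, Pi.single_eq_of_ne (Fin.succ_ne_zero j).symm, add_zero]
  · simp only [Fin.cons_succ, Pi.add_apply, Pi.single_apply, Fin.succ_inj]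

/-- **Each slice link lies in four slice plaquettes.** If a plaquette functional `P y j k` is
bounded by `4` times the deviations of its four links `(y,j), (y+e_j,k), (y+e_k,j), (y,k)`, then
`Σ_y Σ_{j<k} P y j k ≤ 16 Σ_j Σ_y D y j` (reindex the site sums by the translations
`y ↦ y + e_j`; each direction lies in two of the three pairs `j < k` of `Fin 3`). [folklore] -/
theorem slice_sum_le {Y : Type*} [Fintype Y] [AddCommGroup Y] (e : Fin 3 → Y)
    (P : Y → Fin 3 → Fin 3 → ℝ) (D : Y → Fin 3 → ℝ)
    (hP : ∀ y j k, P y j k ≤ 4 * (D y j + D (y + e j) k + D (y + e k) j + D y k)) :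
    ∑ y, ∑ j : Fin 3, ∑ k : Fin 3, (if j < k then P y j k else 0) ≤
      16 * ∑ j : Fin 3, ∑ y, D y j := by
  have hshift : ∀ j k, ∑ y, D (y + e j) k = ∑ y, D y k := fun j k =>
    Fintype.sum_equiv (Equiv.addRight (e j)) _ _ fun _ => rfl
  have hjk : ∀ j k : Fin 3, ∑ y, (if j < k then P y j k else 0) ≤
      (if j < k then 1 else 0) * (8 * ((∑ y, D y j) + ∑ y, D y k)) := by
    intro j k
    split_ifs with hlt
    · rw [one_mul]
      calc ∑ y, P y j k ≤ ∑ y, 4 * (D y j + D (y + e j) k + D (y + e k) j + D y k) :=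
            Finset.sum_le_sum fun y _ => hP y j k
        _ = 8 * ((∑ y, D y j) + ∑ y, D y k) := by
            rw [← Finset.mul_sum]
            simp only [Finset.sum_add_distrib, hshift]
            ring
    · simp
  calc ∑ y, ∑ j : Fin 3, ∑ k : Fin 3, (if j < k then P y j k else 0)
      = ∑ j : Fin 3, ∑ k : Fin 3, ∑ y, (if j < k then P y j k else 0) := by
        rw [Finset.sum_comm]
        exact Finset.sum_congr rfl fun j _ => Finset.sum_comm
    _ ≤ ∑ j : Fin 3, ∑ k : Fin 3, (if j < k then 1 else 0) * (8 * ((∑ y, D y j) + ∑ y, D y k)) :=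
        Finset.sum_le_sum fun j _ => Finset.sum_le_sum fun k _ => hjk j k
    _ = 16 * ∑ j : Fin 3, ∑ y, D y j := by
        have h01 : (0 : Fin 3) < 1 := by decide
        have h02 : (0 : Fin 3) < 2 := by decide
        have h12 : (1 : Fin 3) < 2 := by decide
        have h10 : ¬ (1 : Fin 3) < 0 := by decide
        have h20 : ¬ (2 : Fin 3) < 0 := by decide
        have h21 : ¬ (2 : Fin 3) < 1 := by decide
        simp only [Fin.sum_univ_three, h01, h02, h12, h10, h20, h21, lt_self_iff_false, if_true,
          if_false]
        ring

end GaugeAlgebra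

open GaugeAlgebra in
/-- **Stub `stub_gaugeAlgebra` (ALGEBRA — any gauge)** of the line `SketchIdeator1` for the crux
`BrascampLiebVacuumSC`. For unitary `V`, `‖½(V − Vᴴ)‖²_F = 2(N − Re tr V) − ‖1 − ½(V + Vᴴ)‖²_F`;
for a plaquette `P = V₁V₂V₃⁻¹V₄⁻¹`, `N − Re tr P ≤ 4 Σᵢ (N − Re tr Vᵢ)`; every time-zero spatial
link lies in exactly four time-zero spatial plaquettes, and `N − Re tr ρ(U_p)` is gauge invariant.
Hence in every gauge `h`:
`(1/8) Σ_{p ⊂ slice} (N − Re tr ρ(U_p)) − Σ_{ℓ ⊂ slice} ‖1 − ½(ρ(U^h_ℓ) + ρ(U^h_ℓ)ᴴ)‖²_F`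
`≤ Σ_{ℓ ⊂ slice} ‖A^h_ℓ‖²_F`. [folklore] -/
theorem stub_gaugeAlgebra :
    ∀ (G : Type) [Group G] [TopologicalSpace G] (r : LatticeRep G) (S : ℕ)
    (U : GaugeConfig 4 (2 * S + 1) G) (h : Site 4 (2 * S + 1) → G),
    (1 / 8 : ℝ) * (∑ y : Fin 3 → ZMod (2 * S + 1), ∑ j : Fin 3, ∑ k : Fin 3,
        if j < k then ((r.N : ℝ) - (r.ρ (plaquetteHolonomy U (Fin.cons (0 : ZMod (2 * S + 1)) y)
          j.succ k.succ)).trace.re) else 0) -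
      (∑ y : Fin 3 → ZMod (2 * S + 1), ∑ j : Fin 3,
        froSq (1 - (1 / 2 : ℂ) • (r.ρ (gaugeTransform h U (Fin.cons (0 : ZMod (2 * S + 1)) y, j.succ)) +
          (r.ρ (gaugeTransform h U (Fin.cons (0 : ZMod (2 * S + 1)) y, j.succ)))ᴴ))) ≤
    ∑ j : Fin 3, ∑ y : Fin 3 → ZMod (2 * S + 1), froSq (gluon r S U h y j) := by
  intro G _ _ r S U h
  -- (2) + (3): the plaquette sum against the link deviations, in the gauge `h`
  have hP := slice_sum_le (Y := Fin 3 → ZMod (2 * S + 1)) (fun j => Pi.single j 1)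
    (fun y j k => (r.N : ℝ) -
      (r.ρ (plaquetteHolonomy U (Fin.cons (0 : ZMod (2 * S + 1)) y) j.succ k.succ)).trace.re)
    (fun y j => (r.N : ℝ) -
      (r.ρ (gaugeTransform h U (Fin.cons (0 : ZMod (2 * S + 1)) y, j.succ))).trace.re)
    (fun y j k => by
      have hb := dev_plaquetteHolonomy_le r U h (Fin.cons (0 : ZMod (2 * S + 1)) y) j.succ k.succ
      rwa [cons_zero_shift_succ, cons_zero_shift_succ] at hb)
  beta_reduce at hP
  -- (1): `‖A_ℓ‖² = 2 dev_ℓ − hdev_ℓ`, summed over the slice links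
  have hA : ∀ (y : Fin 3 → ZMod (2 * S + 1)) (j : Fin 3), froSq (gluon r S U h y j) =
      2 * ((r.N : ℝ) -
        (r.ρ (gaugeTransform h U (Fin.cons (0 : ZMod (2 * S + 1)) y, j.succ))).trace.re) -
      froSq (1 - (1 / 2 : ℂ) •
        (r.ρ (gaugeTransform h U (Fin.cons (0 : ZMod (2 * S + 1)) y, j.succ)) +
          (r.ρ (gaugeTransform h U (Fin.cons (0 : ZMod (2 * S + 1)) y, j.succ)))ᴴ)) :=
    fun y j => froSq_half_sub_conjTranspose_eq r _
  have hR : ∑ j : Fin 3, ∑ y : Fin 3 → ZMod (2 * S + 1), froSq (gluon r S U h y j) =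
      2 * (∑ j : Fin 3, ∑ y : Fin 3 → ZMod (2 * S + 1), ((r.N : ℝ) -
        (r.ρ (gaugeTransform h U (Fin.cons (0 : ZMod (2 * S + 1)) y, j.succ))).trace.re)) -
      ∑ y : Fin 3 → ZMod (2 * S + 1), ∑ j : Fin 3,
        froSq (1 - (1 / 2 : ℂ) •
          (r.ρ (gaugeTransform h U (Fin.cons (0 : ZMod (2 * S + 1)) y, j.succ)) +
            (r.ρ (gaugeTransform h U (Fin.cons (0 : ZMod (2 * S + 1)) y, j.succ)))ᴴ)) := by
    simp only [hA, Finset.sum_sub_distrib, ← Finset.mul_sum]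
    congr 1
    exact Finset.sum_comm
  rw [hR]
  linarith [hP]

end Summit.QuantumFields.YangMills.Theorems.BrascampLiebVacuumSC

end
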